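import Summits.QuantumFields.YangMills.Theorems.F4SubCurvatureDoorShortRootRigidityTrigonalDefs
import Summits.QuantumFields.YangMills.Theorems.F4SubCurvatureDoorShortRootRigidityTrigonalFinish
import Summits.QuantumFields.YangMills.Theorems.F4SubCurvatureDoorShortRootRigidityTrigonalSectoralSpan
import Summits.QuantumFields.YangMills.Theorems.F4SubCurvatureDoorShortRootRigidityTwoReflections
import Literature.Algebra.Polynomial.LaplacianOrthogonalInvariance
import Mathlib
import HarnessLib

/-!
# TorusReduction (§2 of `TrigonalInjectivity.md`) — the END-GAME lemma, typing-independent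

Crux ⟨stmt-QuantumFields-23035⟩ `ShortRootRigidity`, stub `:146 stub_oddModeRigidity`, typed split `odd_mode_split.lean`
(`OddModeRigidity ⇐ AnalyticHalf ∧ TorusReduction ∧ TrigonalInjectivityAll`; `TrigonalInjectivityAll` ✓ by name, bridge B).
The last step of the paper proof of `TorusReduction` (§2, «So all λ_q = 0: every φ_ℓ has no weight in 6ℤ, i.e. φ_ℓ∘σ_d = −φ_ℓ for all d,
so φ_ℓ is fixed by the irrational rotation σ_dσ_{d′} and by O, hence φ_ℓ = 0») is the following statement about ONE real polynomial on
`ℝ³`, with no degree, harmonicity or weight bookkeeping left in it: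

`eq_zero_of_ohInvariant_of_halfTurn_odd`: an `O_h`-invariant polynomial (`OhInvariant` of ✓`…TrigonalDefs`: coordinate permutations and
sign flips) which is ODD under the half-turn about `(1,1,1)` (`x ↦ (2/3)(x₀+x₁+x₂)(1,1,1) − x`; «all trigonal weights odd») is `0`.
Proof: the sign flips give evenness, so oddness under the half-turn is oddness under the reflection `σ₁` in `(1,1,1)^⊥`
(`σ₁ = −(half-turn)`); conjugating by the flip of the third coordinate (✓`σ₂_eq_conj`, frs-p2 g16) gives oddness under the reflection
`σ₂` in `(1,1,−1)^⊥`; ✓`eq_zero_of_odd_under_two_diagonal_reflections` (w3 g38, ✓p726596) concludes.  Also the `Rf`-matrix form.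

HONEST LABEL: one S-sized lemma of the OPEN piece `TorusReduction`; `AnalyticHalf`, `:146`, ⟨23035⟩, ⟨23125⟩ OPEN; the Yang–Mills
mass gap is NOT proved; no summit is proved by a line.
-/

noncomputable section

open MvPolynomial
open scoped BigOperators
open Literature.Algebra.Polynomial
open Summit.QuantumFields.YangMills.Theorems.F4SubCurvatureDoorTrigonalLine (P3 Rf flipMat OhInvariant Rf_mulVec_eq_σ₁ σ₂_eq_conj)
open Summit.QuantumFields.YangMills.Theorems.F4SubCurvatureDoorTwoReflections (σ₁ σ₂ eq_zero_of_odd_under_two_diagonal_reflections)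
open Summit.QuantumFields.YangMills.Theorems.F4SubCurvatureDoorTrigonalSectoralSpan (eval_flip_of_OhInvariant)

namespace Summit.QuantumFields.YangMills.Theorems.F4SubCurvatureDoorTorusReductionEndgame

/-- `Y(−x) = Y(x)` from `O_h`-invariance (the three sign flips). -/
theorem eval_neg_of_OhInvariant {Y : P3} (hO : OhInvariant Y) (x : Fin 3 → ℝ) :
    eval (fun j => -x j) Y = eval x Y := by
  have h0 := eval_flip_of_OhInvariant hO 0 x
  have h1 := eval_flip_of_OhInvariant hO 1 (fun j => if j = (0 : Fin 3) then -x j else x j)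
  have h2 := eval_flip_of_OhInvariant hO 2
    (fun j => if j = (1 : Fin 3) then -(fun j => if j = (0 : Fin 3) then -x j else x j) j
      else (fun j => if j = (0 : Fin 3) then -x j else x j) j)
  have hv : (fun j => -x j) = fun j => if j = (2 : Fin 3) then
      -(fun j => if j = (1 : Fin 3) then -(fun j => if j = (0 : Fin 3) then -x j else x j) j
        else (fun j => if j = (0 : Fin 3) then -x j else x j) j) j
      else (fun j => if j = (1 : Fin 3) then -(fun j => if j = (0 : Fin 3) then -x j else x j) j
        else (fun j => if j = (0 : Fin 3) then -x j else x j) j) j := by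
    funext j
    fin_cases j <;> simp
  rw [hv, h2, h1, h0]

/-- The half-turn about `(1,1,1)` is minus the reflection `σ₁` in `(1,1,1)^⊥`. -/
theorem halfTurn_eq_neg_σ₁ (x : Fin 3 → ℝ) :
    (fun i => 2 / 3 * (x 0 + x 1 + x 2) - x i) = fun j => -(σ₁ x) j := by
  funext i
  simp [σ₁]

/-- `σ₁`-odd ⇒ `σ₂`-odd for an `O_h`-invariant polynomial (conjugation by the flip of the third coordinate). -/
theorem σ₂_odd_of_σ₁_odd {Y : P3} (hO : OhInvariant Y) (h₁ : ∀ x, eval (σ₁ x) Y = -eval x Y) (x : Fin 3 → ℝ) :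
    eval (σ₂ x) Y = -eval x Y := by
  have hF : ∀ z : Fin 3 → ℝ, eval ((flipMat 2).mulVec z) Y = eval z Y := by
    intro z
    have h := congrArg (eval z) (hO.2 2)
    rw [eval_bind₁_linSubst] at h
    exact h
  rw [σ₂_eq_conj, hF, h₁, hF]

/-- **END-GAME LEMMA of §2.**  An `O_h`-invariant real polynomial on `ℝ³` which is odd under the half-turn about `(1,1,1)`
(«every trigonal weight is odd») vanishes. [TrigonalInjectivity.md §2, last step; ingredients ✓p726596, ✓TrigonalFinish] -/
theorem eq_zero_of_ohInvariant_of_halfTurn_odd (Y : P3) (hO : OhInvariant Y)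
    (hodd : ∀ x : Fin 3 → ℝ, eval (fun i => 2 / 3 * (x 0 + x 1 + x 2) - x i) Y = -eval x Y) : Y = 0 := by
  have h₁ : ∀ x, eval (σ₁ x) Y = -eval x Y := by
    intro x
    have h := hodd x
    rw [halfTurn_eq_neg_σ₁, eval_neg_of_OhInvariant hO] at h
    exact h
  exact eq_zero_of_odd_under_two_diagonal_reflections Y h₁ (σ₂_odd_of_σ₁_odd hO h₁)

/-- The same with the oddness stated through the sub-skeleton's reflection matrix `Rf = 1 − 2J/3` (`Rf·x = σ₁ x`):
an `O_h`-invariant polynomial with `Y∘σ = −Y` is `0` — `stub_finish` of `Lines/trigonal_injectivity.lean` WITHOUT its idle degree and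
harmonicity hypotheses, so that it applies to every `φ_ℓ` of §2. -/
theorem eq_zero_of_ohInvariant_of_Rf_odd (Y : P3) (hO : OhInvariant Y) (hodd : bind₁ (linSubst Rf) Y = -Y) : Y = 0 := by
  have h₁ : ∀ x, eval (σ₁ x) Y = -eval x Y := by
    intro x
    have h := congrArg (eval x) hodd
    rw [eval_bind₁_linSubst, Rf_mulVec_eq_σ₁, map_neg] at h
    exact h
  exact eq_zero_of_odd_under_two_diagonal_reflections Y h₁ (σ₂_odd_of_σ₁_odd hO h₁)

/-- Contrapositive reading used in §2: a NON-ZERO `O_h`-invariant polynomial takes the same value at some point and its half-turn image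
with the SAME sign somewhere — i.e. it has a non-zero even trigonal weight. -/
theorem exists_halfTurn_ne_neg_of_ne_zero (Y : P3) (hO : OhInvariant Y) (hY : Y ≠ 0) :
    ∃ x : Fin 3 → ℝ, eval (fun i => 2 / 3 * (x 0 + x 1 + x 2) - x i) Y ≠ -eval x Y := by
  by_contra h
  push Not at h
  exact hY (eq_zero_of_ohInvariant_of_halfTurn_odd Y hO h)

end Summit.QuantumFields.YangMills.Theorems.F4SubCurvatureDoorTorusReductionEndgame

end
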